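/-
Origin: expansion seat `prover-pub-hodgecm-mc-sinst-1-g5-0`, handover #1229 2026-08-20T12:40Z md5 9f5ed77dc591 (168 l., 11 decls: 2 abbrevs + 9 theorems) NEW additive leaf, ns HodgeCM.Model.SInstance; imports #1228 (this kit) + RUN-50 #1227 ThetaAdelicSideR1J + carch-1 RUN-51 #CA55 ArchKTypeOfLineR2Family (CROSS-KIT ROWDEP: install after #CA53 #CA54 #CA55); the constructed pin R2 SROGT'C (χVR, νR, ν'R) and its (J-μ)-closed form SROGT'CJ; NAME LIST: HodgeCM.Model.SInstance.SROGT'C_eq_archSideOfT' · HodgeCM.Model.SInstance.hT_ROGT'C · HodgeCM.Model.SInstance.SROGT'CJ_eq_archSideOfT' (`HOME/mc/pub-hodgecm-mc-sinst-1-g5/stage/HodgeCM/Model/ThetaAdelicSideR2.lean`, md5 9f5ed77dc591, 168 lines);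
landed by the gen-20 packager (p-g20) in gate run 51 as `HodgeCM/Model/ThetaAdelicSideR2.lean` (verbatim).
-/
/-
Origin: CONSTRUCTION seat `prover-pub-hodgecm-mc-sinst-1-g5-0` (unit pub-hodgecm-mc-sinst-1-g5, gen 5 of mc-sinst-1 — S-INSTANCE CONSTRUCTOR,
BINDER-OWNERS row 5 `S`), 2026-08-20; carch-1-g5's R2 ask.  KERNEL only: 2 abbrevs + theorems; closure {propext, Classical.choice, Quot.sound}.
Additive leaf over `ThetaAdelicSideGuardedT2` (this kit), #1227 `ThetaAdelicSideR1J` and carch-1 RUN-51 #CA55 `ArchKTypeOfLineR2Family`;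
nothing of PerL ∕ QW8 is claimed.
-/
import Summits.HodgeConjecture.HodgeCM.Model.ThetaAdelicSideGuardedT2_2
import Summits.HodgeConjecture.HodgeCM.Model.ThetaAdelicSideR1J
import Summits.HodgeConjecture.HodgeCM.Model.ArchKTypeOfLineR2Family

/-!
# (C-LINE34) R2, S SIDE: the row-5 pin with `χV`, `ν` AND the second twist `ν′` CONSTRUCTED — `SInstance.SROGT'C` / `SROGT'CJ`

carch-1-g5's R2 ask (STATUS 2026-08-20 12:04Z), over `ThetaAdelicSideGuardedT2` (the guarded families `SROGT'` over period-1's doubly twisted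
term `archSideOfT'`, #P50b) and carch-1's RUN-51 #CA55 `ArchKTypeOfLineR2Family` (the second-twist family `SInstance.ν'R @hGR₃ := νOf ν₃R` with
its slots `hν'R`, `hν'cR`): exactly as #1216 `ThetaAdelicSideR1` plugged `χVR`, `νR` into #1215's `SROGT`, this leaf plugs

  `χV := SInstance.χVR @hGR @hGR₀ @hGR₁`, `ν := SInstance.νR @hGR₁` (`hνR`, `hνcR`), `ν′ := SInstance.ν'R @hGR₃` (`hν'R`, `hν'cR`)

into `SROGT'`, giving

* §1 **`SInstance.SROGT'C @hGR @hGR₀ @hGR₁ @hGR₂ @hGR₃ @μ hΔ₁ hΔ₂ hΔ₃ : ∀ V c, ThetaAdelicSide V c`** — PIN R2: inputs the five [GR91 3.1.1]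
  splitting families, E's `μ` table and the three guarded (J-μ) identities ONLY; `SROGT'C_eq_SROGT'` (rfl), rows `hLF` / 13 hypothesis-free
  (`hLF_ROGT'C`, `hT_ROGT'C`), **`SROGT'C_eq_archSideOfT'`**: under `GOG V c` the pin IS period-1's
  `archSideOfT' … (EtaChi.η χVR (χWR μ) V c) … (νR V c) … (ν'R V c) … (hG_GOG V c hc) (ART' … V c hc)` — so carch's eight row-12 theorems
  (#1216 § 2 for k = 0,1; #CA55 `hdef/hχ_three/two_R2_of_GOG` for k = 2,3) and #CA57 `hsupply_two_three_archSideOfT'_of_GOG` apply at the pin;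
  `SROGT'C_P_ω` (the line kernels are `lineRepT' … k`);
* §2 **`SInstance.SROGT'CJ @hGR @hGR₀ @hGR₁ @hGR₂ @hGR₃ @μ`** — PIN R2 WITH NO PROVE INPUT: `SROGT'C` at `μ♯♯ := ArchSideTerm.muSharp₂₃ μ` with the
  three (J-μ) identities supplied by the kernel theorems `hΔ₁_GOG_muSharp₂₃` ((K10)) and `hΔ₂/hΔ₃_GOG_muSharp₂₃_holds` (#1226), as #1227 `SROGTCJ`
  does for pin R1; `SROGT'CJ_eq` (rfl), `hT_ROGT'CJ`, `hLF_ROGT'CJ`, `SROGT'CJ_eq_archSideOfT'`.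
Nothing here is a claim of PerL/QW8; nothing is cited as a fact; 0 records, 0 `def … : Prop`.
-/


set_option autoImplicit false

noncomputable section

open scoped Matrix Classical
open Literature.NumberTheory.Automorphic Literature.NumberTheory.Weil1964
open Literature.NumberTheory.GelbartRogawski1991.UnitaryDualPair
open HodgeCM.Adelic HodgeCM.PerL34
open Literature.Geometry.ComplexHyperbolic.BallModel (U21 x₀ stabilizerEquivK21)
open Literature.NumberTheory.Automorphic.U21 (matA sclD)

namespace HodgeCM.Model.SInstance

open HodgeCM.Model.ArchSideTerm

variable
  (hGR : ∀ {L : CMField} {ι₁ : L →+* ℂ} (V : HermSpace3 L ι₁) (c : SeesawCtx L),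
    (cmSplittingDatum (L : Type) finProdFinEquiv (frameD V) (frameD_real V) (frameD_ne V) (dW c.D) (dW_real c.D)
      (dW_ne c.D)).CompatibleSplitting)
  (hGR₀ : ∀ {L : CMField} {ι₁ : L →+* ℂ} (V : HermSpace3 L ι₁) (c : SeesawCtx L),
    (cmSplittingDatum (L : Type) (e₁) (frameD V) (frameD_real V) (frameD_ne V) (lineVec (L : Type) (dW c.D 0))
      (fun _ => dW_real c.D 0) (fun _ => dW_ne c.D 0)).CompatibleSplitting)
  (hGR₁ : ∀ {L : CMField} {ι₁ : L →+* ℂ} (V : HermSpace3 L ι₁) (c : SeesawCtx L),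
    (cmSplittingDatum (L : Type) (e₁) (frameD V) (frameD_real V) (frameD_ne V) (lineVec (L : Type) (dW c.D 1))
      (fun _ => dW_real c.D 1) (fun _ => dW_ne c.D 1)).CompatibleSplitting)
  (hGR₂ : ∀ {L : CMField} {ι₁ : L →+* ℂ} (V : HermSpace3 L ι₁) (c : SeesawCtx L),
    (cmSplittingDatum (L : Type) (e₁) (frameD V) (frameD_real V) (frameD_ne V) (lineVec (L : Type) (dW' c.D 0))
      (fun _ => dW'_real c.D 0) (fun _ => dW'_ne c.D 0)).CompatibleSplitting)
  (hGR₃ : ∀ {L : CMField} {ι₁ : L →+* ℂ} (V : HermSpace3 L ι₁) (c : SeesawCtx L),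
    (cmSplittingDatum (L : Type) (e₁) (frameD V) (frameD_real V) (frameD_ne V) (lineVec (L : Type) (dW' c.D 1))
      (fun _ => dW'_real c.D 1) (fun _ => dW'_ne c.D 1)).CompatibleSplitting)
  (μ : ∀ {L : CMField}, SeesawCtx L → Fin 4 → NumberField.InfinitePlace (L : Type) → ℤ)

/-! ## § 1 the constructed pin R2 `SROGT'C` -/

/-- **THE CONSTRUCTED ROW-5 PIN R2 AT THE OG GUARD** (`orientBitι`): `SROGT'` at `χV := χVR`, `ν := νR` (`hνR`, `hνcR`; carch #CA35) and
`ν′ := ν'R` (`hν'R`, `hν'cR`; carch #CA55) — pin inputs hGR×5, `μ` and the three guarded (J-μ) identities ONLY. -/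
abbrev SROGT'C
    (hΔ₁ : ∀ {L : CMField} {ι₁ : L →+* ℂ} (V : HermSpace3 L ι₁) (c : SeesawCtx L), ∀ hc : GOG V c,
      slotTypeVec V c (hGR V c) (hGR₀ V c) (hGR₁ V c) (hGR₂ V c) (hGR₃ V c) (hG_GOG V c hc) 1 -
        slotTypeVec V c (hGR V c) (hGR₀ V c) (hGR₁ V c) (hGR₂ V c) (hGR₃ V c) (hG_GOG V c hc) 0 = μ c 1 - μ c 0)
    (hΔ₂ : ∀ {L : CMField} {ι₁ : L →+* ℂ} (V : HermSpace3 L ι₁) (c : SeesawCtx L), ∀ hc : GOG V c,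
      slotTypeVec V c (hGR V c) (hGR₀ V c) (hGR₁ V c) (hGR₂ V c) (hGR₃ V c) (hG_GOG V c hc) 2 -
        slotTypeVec V c (hGR V c) (hGR₀ V c) (hGR₁ V c) (hGR₂ V c) (hGR₃ V c) (hG_GOG V c hc) 0 = μ c 2 - μ c 0)
    (hΔ₃ : ∀ {L : CMField} {ι₁ : L →+* ℂ} (V : HermSpace3 L ι₁) (c : SeesawCtx L), ∀ hc : GOG V c,
      slotTypeVec V c (hGR V c) (hGR₀ V c) (hGR₁ V c) (hGR₂ V c) (hGR₃ V c) (hG_GOG V c hc) 3 -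
        slotTypeVec V c (hGR V c) (hGR₀ V c) (hGR₁ V c) (hGR₂ V c) (hGR₃ V c) (hG_GOG V c hc) 0 = μ c 3 - μ c 0) :
    ∀ {L : CMField} {ι₁ : L →+* ℂ} (V : HermSpace3 L ι₁) (c : SeesawCtx L), ThetaAdelicSide V c :=
  SROGT' @hGR @(@χVR @hGR @hGR₀ @hGR₁) @(@νR @hGR₁) @(@hνR @hGR₁) @(@hνcR @hGR₁) @(@ν'R @hGR₃) @(@hν'R @hGR₃) @(@hν'cR @hGR₃)
    @hGR₀ @hGR₁ @hGR₂ @hGR₃ @μ hΔ₁ hΔ₂ hΔ₃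

/-- `SROGT'C` is `SROGT'` at carch-1's constructed families (definitional). -/
theorem SROGT'C_eq_SROGT' (hΔ₁ hΔ₂ hΔ₃) {L : CMField} {ι₁ : L →+* ℂ} (V : HermSpace3 L ι₁) (c : SeesawCtx L) :
    SROGT'C @hGR @hGR₀ @hGR₁ @hGR₂ @hGR₃ @μ hΔ₁ hΔ₂ hΔ₃ V c =
      SROGT' @hGR @(@χVR @hGR @hGR₀ @hGR₁) @(@νR @hGR₁) @(@hνR @hGR₁) @(@hνcR @hGR₁) @(@ν'R @hGR₃) @(@hν'R @hGR₃) @(@hν'cR @hGR₃)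
        @hGR₀ @hGR₁ @hGR₂ @hGR₃ @μ hΔ₁ hΔ₂ hΔ₃ V c :=
  rfl

/-- **row 13 `hT` at the constructed pin R2, hypothesis-free.** -/
theorem hT_ROGT'C (hΔ₁ hΔ₂ hΔ₃) : ∀ {L : CMField} {ι₁ : L →+* ℂ} (V : HermSpace3 L ι₁) (c : SeesawCtx L) (k : Fin 4) (N : ℕ),
    ((SROGT'C @hGR @hGR₀ @hGR₁ @hGR₂ @hGR₃ @μ hΔ₁ hΔ₂ hΔ₃ V c).P k).IsThetaArchContinuous N :=
  hT_ROGT' _ _ _ _ _ _ _ _ _ _ _ _ _ hΔ₁ hΔ₂ hΔ₃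

/-- `hLF` at the constructed pin R2, hypothesis-free. -/
theorem hLF_ROGT'C (hΔ₁ hΔ₂ hΔ₃) : ∀ {L : CMField} {ι₁ : L →+* ℂ} (V : HermSpace3 L ι₁) (c : SeesawCtx L) (k : Fin 4),
    ((SROGT'C @hGR @hGR₀ @hGR₁ @hGR₂ @hGR₃ @μ hΔ₁ hΔ₂ hΔ₃ V c).P k).IsLFAction :=
  hLF_ROGT' _ _ _ _ _ _ _ _ _ _ _ _ _ hΔ₁ hΔ₂ hΔ₃

/-- **under the OG guard the constructed pin R2 IS period-1's doubly twisted term** at `η := EtaChi.η χVR (χWR μ)`, `ν := νR V c`,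
`ν′ := ν'R V c`, `h₁W := hG_GOG V c hc` and the transported read-off inputs `ART'` — so carch's cross-checked row-12 sockets and #CA57 apply. -/
theorem SROGT'C_eq_archSideOfT' (hΔ₁ hΔ₂ hΔ₃) {L : CMField} {ι₁ : L →+* ℂ} (V : HermSpace3 L ι₁) (c : SeesawCtx L) (hc : GOG V c) :
    SROGT'C @hGR @hGR₀ @hGR₁ @hGR₂ @hGR₃ @μ hΔ₁ hΔ₂ hΔ₃ V c =
      archSideOfT' V c (hGR V c) (hGR₀ V c) (hGR₁ V c) (hGR₂ V c) (hGR₃ V c)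
        (EtaChi.η (@χVR @hGR @hGR₀ @hGR₁) (@χWR @hGR @hGR₀ @hGR₁ @μ) V c)
        (EtaChi.hη (@χVR @hGR @hGR₀ @hGR₁) (@χWR @hGR @hGR₀ @hGR₁ @μ) V c)
        (EtaChi.hηc (@χVR @hGR @hGR₀ @hGR₁) (@χWR @hGR @hGR₀ @hGR₁ @μ) V c)
        (νR @hGR₁ V c) (hνR @hGR₁ V c) (hνcR @hGR₁ V c) (ν'R @hGR₃ V c) (hν'R @hGR₃ V c) (hν'cR @hGR₃ V c) (hG_GOG V c hc)
        (ART' @GOG @hG_GOG @hGR @(@χVR @hGR @hGR₀ @hGR₁) @(@νR @hGR₁) @(@ν'R @hGR₃) @hGR₀ @hGR₁ @hGR₂ @hGR₃ @μ @hpos_GOG @hΔ₁ @hΔ₂ @hΔ₃ V c hc) :=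
  thetaAdelicSideOfPT'_eq_archSideOfT' V c (GOG V c) _ _ _ _ _ _ _ _ _ _ _ _ _ _ _ _ hc

/-- read-back of a line kernel of the constructed pin R2 under the guard: `(P k).ω = lineRepT' … (EtaChi.η χVR χWR V c) (νR V c) (ν'R V c) k`. -/
theorem SROGT'C_P_ω (hΔ₁ hΔ₂ hΔ₃) {L : CMField} {ι₁ : L →+* ℂ} (V : HermSpace3 L ι₁) (c : SeesawCtx L) (hc : GOG V c) (k : Fin 4) :
    ((SROGT'C @hGR @hGR₀ @hGR₁ @hGR₂ @hGR₃ @μ hΔ₁ hΔ₂ hΔ₃ V c).P k).ω =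
      lineRepT' V c.D (hGR V c) (hGR₀ V c) (hGR₁ V c) (hGR₂ V c) (hGR₃ V c)
        (EtaChi.η (@χVR @hGR @hGR₀ @hGR₁) (@χWR @hGR @hGR₀ @hGR₁ @μ) V c) (νR @hGR₁ V c) (ν'R @hGR₃ V c) k := by
  rw [SROGT'C_eq_archSideOfT' @hGR @hGR₀ @hGR₁ @hGR₂ @hGR₃ @μ hΔ₁ hΔ₂ hΔ₃ V c hc]
  rfl

/-! ## § 2 pin R2 with NO PROVE input: `SROGT'CJ` -/

/-- **PIN R2 WITH NO PROVE INPUT**: `SROGT'C` at `μ♯♯ := ArchSideTerm.muSharp₂₃ μ` with the three guarded (J-μ) identities supplied by the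
kernel theorems `hΔ₁_GOG_muSharp₂₃` (K10) and `hΔ₂/hΔ₃_GOG_muSharp₂₃_holds` (#1226); inputs hGR×5 (CITE [GR91 3.1.1]) and `μ` (DATA) only. -/
abbrev SROGT'CJ : ∀ {L : CMField} {ι₁ : L →+* ℂ} (V : HermSpace3 L ι₁) (c : SeesawCtx L), ThetaAdelicSide V c :=
  SROGT'C @hGR @hGR₀ @hGR₁ @hGR₂ @hGR₃ (ArchSideTerm.muSharp₂₃ @μ)
    (ArchSideTerm.hΔ₁_GOG_muSharp₂₃ @hGR @hGR₀ @hGR₁ @hGR₂ @hGR₃ @μ)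
    (ArchSideTerm.hΔ₂_GOG_muSharp₂₃_holds @hGR @hGR₀ @hGR₁ @hGR₂ @hGR₃ @μ)
    (ArchSideTerm.hΔ₃_GOG_muSharp₂₃_holds @hGR @hGR₀ @hGR₁ @hGR₂ @hGR₃ @μ)

/-- `SROGT'CJ` IS `SROGT'C` at `μ♯♯` and the three (J-μ) theorems, the latter spelled through (K10)'s socket `… (hSV_holds hGR)` (definitional). -/
theorem SROGT'CJ_eq {L : CMField} {ι₁ : L →+* ℂ} (V : HermSpace3 L ι₁) (c : SeesawCtx L) :
    SROGT'CJ @hGR @hGR₀ @hGR₁ @hGR₂ @hGR₃ @μ V c =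
      SROGT'C @hGR @hGR₀ @hGR₁ @hGR₂ @hGR₃ (ArchSideTerm.muSharp₂₃ @μ)
        (ArchSideTerm.hΔ₁_GOG_muSharp₂₃ @hGR @hGR₀ @hGR₁ @hGR₂ @hGR₃ @μ)
        (ArchSideTerm.hΔ₂_GOG_muSharp₂₃ @hGR @hGR₀ @hGR₁ @hGR₂ @hGR₃ @μ (ArchSideTerm.hSV_holds @hGR))
        (ArchSideTerm.hΔ₃_GOG_muSharp₂₃ @hGR @hGR₀ @hGR₁ @hGR₂ @hGR₃ @μ (ArchSideTerm.hSV_holds @hGR)) V c :=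
  rfl

/-- **row 13 `hT` at pin R2 with no PROVE input, hypothesis-free.** -/
theorem hT_ROGT'CJ : ∀ {L : CMField} {ι₁ : L →+* ℂ} (V : HermSpace3 L ι₁) (c : SeesawCtx L) (k : Fin 4) (N : ℕ),
    ((SROGT'CJ @hGR @hGR₀ @hGR₁ @hGR₂ @hGR₃ @μ V c).P k).IsThetaArchContinuous N :=
  hT_ROGT'C @hGR @hGR₀ @hGR₁ @hGR₂ @hGR₃ (ArchSideTerm.muSharp₂₃ @μ) _ _ _

/-- `hLF` at pin R2 with no PROVE input, hypothesis-free. -/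
theorem hLF_ROGT'CJ : ∀ {L : CMField} {ι₁ : L →+* ℂ} (V : HermSpace3 L ι₁) (c : SeesawCtx L) (k : Fin 4),
    ((SROGT'CJ @hGR @hGR₀ @hGR₁ @hGR₂ @hGR₃ @μ V c).P k).IsLFAction :=
  hLF_ROGT'C @hGR @hGR₀ @hGR₁ @hGR₂ @hGR₃ (ArchSideTerm.muSharp₂₃ @μ) _ _ _

/-- under the OG guard pin R2 with no PROVE input IS period-1's doubly twisted term at `η := EtaChi.η χVR (χWR μ♯♯)`, `νR`, `ν'R`, `ART'` at `μ♯♯`. -/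
theorem SROGT'CJ_eq_archSideOfT' {L : CMField} {ι₁ : L →+* ℂ} (V : HermSpace3 L ι₁) (c : SeesawCtx L) (hc : GOG V c) :
    SROGT'CJ @hGR @hGR₀ @hGR₁ @hGR₂ @hGR₃ @μ V c =
      archSideOfT' V c (hGR V c) (hGR₀ V c) (hGR₁ V c) (hGR₂ V c) (hGR₃ V c)
        (EtaChi.η (@χVR @hGR @hGR₀ @hGR₁) (@χWR @hGR @hGR₀ @hGR₁ (ArchSideTerm.muSharp₂₃ @μ)) V c)
        (EtaChi.hη (@χVR @hGR @hGR₀ @hGR₁) (@χWR @hGR @hGR₀ @hGR₁ (ArchSideTerm.muSharp₂₃ @μ)) V c)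
        (EtaChi.hηc (@χVR @hGR @hGR₀ @hGR₁) (@χWR @hGR @hGR₀ @hGR₁ (ArchSideTerm.muSharp₂₃ @μ)) V c)
        (νR @hGR₁ V c) (hνR @hGR₁ V c) (hνcR @hGR₁ V c) (ν'R @hGR₃ V c) (hν'R @hGR₃ V c) (hν'cR @hGR₃ V c) (hG_GOG V c hc)
        (ART' @GOG @hG_GOG @hGR @(@χVR @hGR @hGR₀ @hGR₁) @(@νR @hGR₁) @(@ν'R @hGR₃) @hGR₀ @hGR₁ @hGR₂ @hGR₃ (ArchSideTerm.muSharp₂₃ @μ) @hpos_GOG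
          (ArchSideTerm.hΔ₁_GOG_muSharp₂₃ @hGR @hGR₀ @hGR₁ @hGR₂ @hGR₃ @μ)
          (ArchSideTerm.hΔ₂_GOG_muSharp₂₃_holds @hGR @hGR₀ @hGR₁ @hGR₂ @hGR₃ @μ)
          (ArchSideTerm.hΔ₃_GOG_muSharp₂₃_holds @hGR @hGR₀ @hGR₁ @hGR₂ @hGR₃ @μ) V c hc) :=
  SROGT'C_eq_archSideOfT' @hGR @hGR₀ @hGR₁ @hGR₂ @hGR₃ (ArchSideTerm.muSharp₂₃ @μ) _ _ _ V c hc

end HodgeCM.Model.SInstance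

end
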